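/-
Copyright (c) 2026. Released under Apache 2.0 license as described in the file LICENSE.
Track B ∕ K2-LIT (cell `hodgecm-mathlib`, squad K2, ENGINE E1), crux h413 = `stmt-HodgeConjecture-24833`, route of record `HCCMUnconditional`.
Prover seat `hodgecm-mathlib-K2E3-p12` (g7).  Deal «P8 PROPER» (K2E1-plan (g5) 09:13:55Z, ruling 09:23:38Z), §2 of the closer: ONE BALL, over the concrete Bernstein–Lapid spaces, letters hypothesis-first.
-/
import Summits.HodgeConjecture.HodgeConjecture.Theorems.K2E1BLXSystemPackage               -- ★ G-c (this seat): `exists_xSystem`, `xSystem_existsUnique_of`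
import Summits.HodgeConjecture.HodgeConjecture.Theorems.K2E1BLHeightPowerHolomorphicU2      -- ★ ℓ7 (this seat): `differentiableOn_HN_of_ae_eq_cpow_self` ∕ `_one_sub`
import Summits.HodgeConjecture.HodgeConjecture.Theorems.K2E1TruncatedCuspCompactU2         -- ★ K2: `isCompactOperator_deltaShift_comp_subtypeL_HNcusp_of_cusp_decay`
import Summits.HodgeConjecture.HodgeConjecture.Theorems.K2E1BLSpacesU2                     -- ★ P2a: `sub_cnstN_mem_HNcusp`
import Summits.HodgeConjecture.HodgeConjecture.Theorems.K2E1SphericalHeckeEigenSectionU2   -- ★ P5: `differentiable_integral_mul_borelHeight_cpow` (`ĥ` entire)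
import Summits.HodgeConjecture.HodgeConjecture.Theorems.K2E1BorelEisensteinUDefs           -- ★ `eisensteinSeriesU`, `flatSectionU`
import HarnessLib

/-!
# K2·E1 — `K2E1SphericalEisensteinMeromorphicBallU2`: BERNSTEIN–LAPID ON ONE BALL — the `𝔛`-system over the CONCRETE spaces `𝓗_k(𝔛) = HX k μ`, `𝓗_k(Z_a) = HN k a μZ` with `ι = iota`,
# `π = piN`, `r = restrHN`, `δ = deltaShift`, `P = cnstN`, `ĥ_i(z) = ∫ h_i·H^z`, and a scalar function meromorphic on `ball 0 (n + 2)` equal to `E(φ₀H^z)(g)` on the Godement set —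
# the in-flight analytic heads carried as NAMED LETTERS [arXiv:1911.02342, §4 Claims 3–5 and p. 10]

Track B ∕ K2-LIT, crux h413 = `stmt-HodgeConjecture-24833`, route of record `HCCMUnconditional`; cell `hodgecm-mathlib`, squad K2, ENGINE E1 (campaign EIS-R7-BL-SPH-2, P8 PROPER §2;
rulings 09:13:55Z «HYPOTHESIS-FIRST NOW … carry as NAMED LETTERS exactly the heads still in flight» and 09:23:38Z (letter owners; P6′ uniqueness on `U₀ = ball ∩ {1 < re} ∩ {Im ĥ ≠ 0}`)).
Prover seat `hodgecm-mathlib-K2E3-p12` (g7).  THEOREMS ONLY (no `def`, no `instance`, no notation, no named-fact hypothesis — every letter is an ORDINARY hypothesis with its payer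
named below, no `sorry`); lane `--supports stmt-HodgeConjecture-24833 --as helper` (count-neutral).  Closes no socket.  RANK-GENERIC (`quasiSplit F E c N`): the `N = 3` clone is a rename.

WHAT IS ★ INSIDE (discharged here): the Claim-4 identities `π ∘ r ∘ ι = 1` (§1 `piN_iota`, `restrHN_iota` from ★ `iota_piN`, `coeFn_iota`, injectivity) ; the compact input
`δ_i ∘ (1 − cnstN)` from ★ K2's head on the letter `hK1` (§1 `isCompactOperator_deltaShift_comp_one_sub_cnstN`, via ★ `sub_cnstN_mem_HNcusp`); holomorphy of `ĥ_i` (★ P5) and of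
`α₁ = [H^z]`, `α₂ = [H^{1−z}]` (★ ℓ7, from the `=ᵐ` letters `hα₁ hα₂`); the packaged system, its `hfin` and the `∃!` bookkeeping (★ G-c); Thm 2.3 and the scalarisation (★ P1a, ★ G-a) in the
generalised form §1 `exists_meromorphicOn_scalar_of_system'` (uniqueness required only on SOME open non-empty `U₀ ⊆ D ∩ O` — P6′'s `{Im ĥ_{i₀} ≠ 0}` — while the known solution and the
functional identity live on all of `D ∩ O`; Thm 2.3 propagates uniqueness).
THE LETTERS (payer ∕ status 09:30Z): `hb hb₀ hcl hinj` = ι-package at levels `a < a₀ i` (★ K2E1-p08 `iotaBound_cm`, `exists_pos_iota_closedEmbedding_cm`: choose `a₀ i < c₁`); `hfin : μZ(Z_a) < ∞`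
and `[IsFiniteMeasure (weightedTruncMeasure k (a₀ i) μZ)]` (★ `isFiniteMeasure_weightedTruncMeasure_cm`); `hs i : ShiftBound …(h i)` (★ p858908 `shiftBound_of_isCompact` mod `hright`);
`hK1 i` = ★ K2 p858828's binder VERBATIM (K1-L² K2E1-p11 + `hmass`); `T i` + `hδι i` = P3-C `exists_shiftOperatorX` + intertwining (K2E1-p09); `hcov` = finite good family (★ P6 §5 + ★ G-a
`exists_finset_forall_exists_ne_zero_closedBall`, or P5c); `eX bX hsolT hsolC hsolQ` = the Eisenstein data in `HX` ((b1) K2E4-p23 + ℓ9 `hHecke` + ★ P2b-A∕P7 constant term + ★ P7-B ⊥);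
`Λ hΛ` = ℓ12 P3-D (K2E1-p09); `hunq` = ℓ11 P6′ `K2E1BLUniquenessSelfAdjointU2` (K2E1-p02); `hα₁ hα₂ hα₂ne` = `toHN` of `H^z`, `H^{1−z}` (`coeFn_toHN`; non-zero class since `μZ(Z_a) > 0`).
§1 `exists_meromorphicOn_scalar_of_system'`, `piN_iota`, `restrHN_iota`, `piN_comp_restrHN_comp_iota`, `isCompactOperator_deltaShift_comp_one_sub_cnstN`.
§2 **`sphericalEisenstein_meromorphicOn_ball_of_letters`** — `∃ Ec : ℂ → ℂ, MeromorphicOn Ec (ball 0 (n + 2)) ∧ ∀ z ∈ ball 0 (n + 2), 1 < z.re → Ec z = E(φ₀H^z)(g)` = EXACTLY the `hball n g`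
clause of ★ `sphericalEisenstein_meromorphic_of_balls` (P8 §1).
HONEST LABEL: HC_CM is proved only modulo the 7 printed citations (2 remaining named inputs: hLiu418 = `stmt-HodgeConjecture-24832`, h413 = `stmt-HodgeConjecture-24833`) until rung 0
closes; this file asserts no named fact and closes no socket; its head is CONDITIONAL on the letters above (ED. 2 removes them by `obtain` as they land).
References: [BernsteinLapid2019] J. Bernstein, E. Lapid, *On the meromorphic continuation of Eisenstein series*, arXiv:1911.02342 (JAMS 37 (2024), doi:10.1090/jams/1020), §2.3, §4 ·
[MoeglinWaldspurger1995] C. Mœglin, J.-L. Waldspurger, *Spectral Decomposition and Eisenstein Series*, I.2.13, IV.1.8.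
-/

set_option autoImplicit false
-- the mandated namespace repeats the single-problem summit's segment (`HodgeConjecture.HodgeConjecture`)
set_option linter.dupNamespace false

noncomputable section

open MeasureTheory Filter Topology Set Submodule NumberField
open scoped NNReal ENNReal Classical
open Literature.NumberTheory.Automorphic Literature.NumberTheory.Automorphic.UnitaryGroup AdelicGroupData
open Summit.HodgeConjecture.HodgeConjecture.Cruxes.H413.K2E1BorelEisensteinU
open Summit.HodgeConjecture.HodgeConjecture.Cruxes.H413.K2E1BLBorelSpacesU2Defs
open Summit.HodgeConjecture.HodgeConjecture.Cruxes.H413.K2E1BLBorelOperatorsU2Defs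
open Summit.HodgeConjecture.HodgeConjecture.Cruxes.H413.K2E1BLSpacesU2 (sub_cnstN_mem_HNcusp)
open Summit.HodgeConjecture.HodgeConjecture.Cruxes.H413.K2E1TruncatedCuspCompactU2 (isCompactOperator_deltaShift_comp_subtypeL_HNcusp_of_cusp_decay)
open Summit.HodgeConjecture.HodgeConjecture.Cruxes.H413.K2E1SphericalHeckeEigenSectionU2 (differentiable_integral_mul_borelHeight_cpow)
open Summit.HodgeConjecture.HodgeConjecture.Cruxes.H413.K2E1MeromorphicSolutionPrincipleLocal (eventually_ne_zero_of_analyticOnNhd)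
open Summit.HodgeConjecture.HodgeConjecture.Cruxes.H413.K2E1BLMeromorphicGluing (meromorphicOn_scalarisation)
open Summit.HodgeConjecture.HodgeConjecture.Cruxes.H413.K2E1BLSystemAssembly (exists_meromorphic_solution_eventually)
open Summit.HodgeConjecture.HodgeConjecture.Cruxes.H413.K2E1BLXSystemPackage (exists_xSystem xSystem_existsUnique_of)
open Summit.HodgeConjecture.HodgeConjecture.Cruxes.H413.K2E1BLHeightPowerHolomorphicU2 (differentiableOn_HN_of_ae_eq_cpow_self differentiableOn_HN_of_ae_eq_cpow_one_sub)

namespace Summit.HodgeConjecture.HodgeConjecture.Cruxes.H413.K2E1SphericalEisensteinMeromorphicBallU2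

/-! ## §1 Generic and structural bricks -/

/-- **PER-BALL ASSEMBLY, uniqueness on a SUB-region** [BernsteinLapid2019, Thm 2.3 + §4 p. 10] — generalises ★ `K2E1BLSystemAssembly.exists_meromorphicOn_scalar_of_system`: the known
solution `e z` and the functional identity `Λ (e z) = ĥ z · E z` are given on all of `D ∩ O`, but uniqueness only on SOME open non-empty `U₀ ⊆ D ∩ O` (Thm 2.3 propagates it to a dense open
subset of `D`).  Conclusion: `∃ Ec` meromorphic on `D` with `Ec = E` on `O`. [cite: BernsteinLapid2019, Thm 2.3 and §4 p. 10] [cite: MoeglinWaldspurger1995, IV.1.8] -/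
theorem exists_meromorphicOn_scalar_of_system' {𝓥 𝓦 : Type*} [NormedAddCommGroup 𝓥] [NormedSpace ℂ 𝓥] [CompleteSpace 𝓥] [NormedAddCommGroup 𝓦] [NormedSpace ℂ 𝓦] [CompleteSpace 𝓦]
    {D : Set ℂ} (hD : IsOpen D) (hDc : IsPreconnected D) {A : ℂ → 𝓥 →L[ℂ] 𝓦} (hA : DifferentiableOn ℂ A D) {c : ℂ → 𝓦} (hc : DifferentiableOn ℂ c D)
    (hfin : ∀ s₀ ∈ D, ∃ W ∈ 𝓝 s₀, ∃ n : ℕ, ∃ e : Fin n → ℂ → 𝓥, (∀ j, DifferentiableOn ℂ (e j) W) ∧ ∀ s ∈ W, ∀ v : 𝓥, A s v = c s → v ∈ span ℂ (Set.range fun j => e j s))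
    {O : Set ℂ} {ĥ : ℂ → ℂ} (hĥ : DifferentiableOn ℂ ĥ D) (hĥne : ∃ z ∈ D, ĥ z ≠ 0) {e : ℂ → 𝓥} (hsol : ∀ z ∈ D ∩ O, A z (e z) = c z)
    (hunq : ∃ U₀ : Set ℂ, IsOpen U₀ ∧ U₀.Nonempty ∧ U₀ ⊆ D ∩ O ∧ ∀ z ∈ U₀, ∀ w : 𝓥, A z w = c z → w = e z) (Λ : 𝓥 →L[ℂ] ℂ) {E : ℂ → ℂ}
    (hΛ : ∀ z ∈ D ∩ O, Λ (e z) = ĥ z * E z) :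
    ∃ Ec : ℂ → ℂ, MeromorphicOn Ec D ∧ ∀ z ∈ O, Ec z = E z := by
  have hĥa : AnalyticOnNhd ℂ ĥ D := hĥ.analyticOnNhd hD
  obtain ⟨z₁, hz₁, hĥ₁⟩ := hĥne
  obtain ⟨U₀, hU₀o, hU₀ne, hU₀D, hU₀unq⟩ := hunq
  have hunq' : ∃ U₀ : Set ℂ, IsOpen U₀ ∧ U₀.Nonempty ∧ U₀ ⊆ D ∧ ∀ s ∈ U₀, ∃! v : 𝓥, A s v = c s :=
    ⟨U₀, hU₀o, hU₀ne, fun s hs => (hU₀D hs).1, fun s hs => ⟨e s, hsol s (hU₀D hs), fun w hw => hU₀unq s hs w hw⟩⟩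
  obtain ⟨v, hv, hev⟩ := exists_meromorphic_solution_eventually hD hDc hA hc hfin hunq'
  refine ⟨fun z => if z ∈ O then E z else (ĥ z)⁻¹ * Λ (v z), meromorphicOn_scalarisation hv Λ hĥa.meromorphicOn E fun z₀ hz₀ => ?_, fun z hz => by simp only [if_pos hz]⟩
  filter_upwards [hev z₀ hz₀, eventually_ne_zero_of_analyticOnNhd hDc hĥa hz₁ hĥ₁ hz₀, mem_nhdsWithin_of_mem_nhds (hD.mem_nhds hz₀)] with z hz hĥz hzD
  intro hzO
  have hvz : e z = v z := (hz (e z)).1 (hsol z ⟨hzD, hzO⟩)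
  exact ⟨hĥz, by rw [← hvz, hΛ z ⟨hzD, hzO⟩]⟩

section Structural

variable {F E : Type} [Field F] [NumberField F] [Field E] [NumberField E] [Algebra F E] {c : E ≃ₐ[F] E} {N : ℕ} [NeZero N]
variable {k : ℕ} {μ : Measure (quasiSplit F E c N).automorphicQuotient} {μZ : Measure (borelQuotient F E c N)}

/-- **`π_{c,k} ∘ ι_{c,k} = 1`** (Claim 4 bullet 1: `ι` injective with `ιπ = P_{range ι}`, so `ι(π(ιf)) = ιf` and injectivity). [cite: BernsteinLapid2019, §4 Claim 4 p. 10] -/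
theorem piN_iota {c₁ : ℝ≥0} (hb : IotaBound F E c N k c₁ μ μZ)
    (hcl : IsClosed ((LinearMap.range (iota hb).toLinearMap : Submodule ℂ (HN F E c N k c₁ μZ)) : Set (HN F E c N k c₁ μZ))) (hinj : Function.Injective (iota hb)) (f : HX F E c N k μ) :
    piN hb hcl hinj (iota hb f) = f := by
  haveI : CompleteSpace (LinearMap.range (iota hb).toLinearMap) := hcl.completeSpace_coe
  refine hinj ?_
  rw [iota_piN]
  exact congrArg Subtype.val (orthogonalProjectionOnto_mem_subspace_eq_self (⟨iota hb f, LinearMap.mem_range_self _ f⟩ : LinearMap.range (iota hb).toLinearMap))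

/-- **`(ι_{c}f)|_{Z_{c₀}} = ι_{c₀}f`** (Claim 4 bullet 2: both are the class of `f ∘ p` for the smaller measure). [cite: BernsteinLapid2019, §4 Claim 4 p. 10] -/
theorem restrHN_iota {c₁ c₀ : ℝ≥0} (h : c₁ ≤ c₀) (hb : IotaBound F E c N k c₁ μ μZ) (hb₀ : IotaBound F E c N k c₀ μ μZ) (f : HX F E c N k μ) :
    restrHN F E c N k h μZ (iota hb f) = iota hb₀ f := by
  rw [restrHN_apply]
  refine Lp.ext ?_
  filter_upwards [MemLp.coeFn_toLp (memLp_restrict F E c N k h μZ (iota hb f)), (weightedTruncMeasure_absolutelyContinuous F E c N k h μZ).ae_le (coeFn_iota hb f),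
    coeFn_iota hb₀ f] with x h1 h2 h3
  rw [h1, h2, h3]

/-- **`π_{c₀} ∘ restr ∘ ι_{c} = 1`** — the letter `hπ` of ★ G-c `exists_xSystem` in the concrete spaces. [cite: BernsteinLapid2019, §4 Claim 4 p. 10] -/
theorem piN_comp_restrHN_comp_iota {c₁ c₀ : ℝ≥0} (h : c₁ ≤ c₀) (hb : IotaBound F E c N k c₁ μ μZ) (hb₀ : IotaBound F E c N k c₀ μ μZ)
    (hcl₀ : IsClosed ((LinearMap.range (iota hb₀).toLinearMap : Submodule ℂ (HN F E c N k c₀ μZ)) : Set (HN F E c N k c₀ μZ))) (hinj₀ : Function.Injective (iota hb₀)) :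
    piN hb₀ hcl₀ hinj₀ ∘L restrHN F E c N k h μZ ∘L iota hb = ContinuousLinearMap.id ℂ (HX F E c N k μ) := by
  refine ContinuousLinearMap.ext fun f => ?_
  rw [ContinuousLinearMap.comp_apply, ContinuousLinearMap.comp_apply, restrHN_iota h hb hb₀, piN_iota, ContinuousLinearMap.coe_id', id_eq]

variable [MeasurableSpace (quasiSplit F E c N).Adelic]

/-- **`δ_{c,c₀}(h) ∘ (1 − cnst_k)` IS COMPACT** from ★ K2's head (compactness of `δ ∘ 𝓗^cusp ↪`) — `1 − cnstN` factors through `𝓗^cusp` (★ `sub_cnstN_mem_HNcusp`); this is the letter `hK`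
of ★ G-c in the concrete spaces, on K2's decay letter `hK1` VERBATIM. [cite: BernsteinLapid2019, §4 proof of Claim 5 («a well-known argument»)] [cite: MoeglinWaldspurger1995, I.2.13] -/
theorem isCompactOperator_deltaShift_comp_one_sub_cnstN {c₁ c₀ : ℝ≥0} (hc₀ : 0 < c₀) [IsFiniteMeasure (weightedTruncMeasure F E c N k c₀ μZ)]
    {νG : Measure (quasiSplit F E c N).Adelic} {h : (quasiSplit F E c N).Adelic → ℂ} (hs : ShiftBound F E c N k c₁ c₀ νG μZ h) {m C : ℝ} (hm : 0 ≤ m) (hC : 0 ≤ C)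
    (hK1 : ∀ f : HNcusp F E c N k c₁ μZ, ∀ᵐ z ∂(weightedTruncMeasure F E c N k c₀ μZ),
      ‖rightConvFun F E c N νG h ((f : HN F E c N k c₁ μZ) : borelQuotient F E c N → ℂ) z‖ ≤ C * ‖f‖ * ((borelQuotHeight F E c N z : ℝ)) ^ (-m)) :
    IsCompactOperator (deltaShift hs ∘L ((1 : HN F E c N k c₁ μZ →L[ℂ] HN F E c N k c₁ μZ) - cnstN F E c N k c₁ μZ)) := by
  have hK2 := isCompactOperator_deltaShift_comp_subtypeL_HNcusp_of_cusp_decay hc₀ hs hm hC hK1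
  have hfac : deltaShift hs ∘L ((1 : HN F E c N k c₁ μZ →L[ℂ] HN F E c N k c₁ μZ) - cnstN F E c N k c₁ μZ) =
      (deltaShift hs ∘L (HNcusp F E c N k c₁ μZ).subtypeL) ∘L
        (((1 : HN F E c N k c₁ μZ →L[ℂ] HN F E c N k c₁ μZ) - cnstN F E c N k c₁ μZ).codRestrict (HNcusp F E c N k c₁ μZ) fun f => by
          simpa only [sub_apply, one_apply_eq_self] using sub_cnstN_mem_HNcusp f) := by
    refine ContinuousLinearMap.ext fun f => ?_
    rfl
  rw [hfac]
  exact hK2.comp_clm _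

end Structural

/-! ## §2 One ball, letters hypothesis-first -/

section Ball

variable {F E : Type} [Field F] [NumberField F] [Field E] [NumberField E] [Algebra F E] {c : E ≃ₐ[F] E} {N : ℕ} [NeZero N]
variable [MeasurableSpace (quasiSplit F E c N).Adelic] [BorelSpace (quasiSplit F E c N).Adelic]

/-- **BERNSTEIN–LAPID ON ONE BALL, LETTERS HYPOTHESIS-FIRST** [BernsteinLapid2019, §4 Claims 3–5 and p. 10, with Thm 2.3 and §2.1].  Data: weight `k ≥ n + 3`; levels `0 < a ≤ a₀ i`
(`i ∈ I` finite, `i₀ ∈ I`); the ι-package `hb hb₀ hcl₀ hinj₀`; `μZ(Z_a) < ∞` and finite weighted measures at the levels `a₀ i`; test functions `h i` (continuous, compact support) with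
transforms `ĥ_i(z) = ∫ h_i·H^z dνG` having no common zero on the ball and `ĥ_{i₀} ≢ 0`; `ShiftBound` letters `hs i`; K2's decay letters `hK1 i`; the `𝔛`-side operators `T i` with the
intertwining `hδι i : δ_i ∘ ι = restr ∘ ι ∘ T_i`; `α₁ =ᵐ H^z`, `α₂ =ᵐ H^{1−z}` (`α₂ ≠ 0`); a cusp-orthogonality operator `Q`; the Eisenstein data `eX z ∈ 𝓗_k(𝔛)`, `bX z` solving the three
conditions on the Godement set; uniqueness of the `ψ`-component on some open non-empty `U₀` inside `ball ∩ {1 < re}`; and a functional `Λ` with `Λ(eX z) = ĥ_{i₀}(z)·E(φ₀H^z)(g)`.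
THEN `∃ Ec : ℂ → ℂ` meromorphic on `ball 0 (n + 2)` with `Ec z = E(φ₀H^z)(g)` for `z` in the ball with `1 < Re z` — the `hball n g` clause of ★ `sphericalEisenstein_meromorphic_of_balls`.
[cite: BernsteinLapid2019, §4 Claims 3–5 and p. 10] [cite: MoeglinWaldspurger1995, IV.1.8] -/
theorem sphericalEisenstein_meromorphicOn_ball_of_letters (n k : ℕ) (hk : (n : ℝ) + 3 ≤ k) {μ : Measure (quasiSplit F E c N).automorphicQuotient}
    {μZ : Measure (borelQuotient F E c N)} (νG : Measure (quasiSplit F E c N).Adelic) [IsFiniteMeasureOnCompacts νG]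
    -- levels and the ι-package
    {I : Type} [Fintype I] (i₀ : I) {a : ℝ≥0} (ha : 0 < a) {a₀ : I → ℝ≥0} (haa₀ : ∀ i, a ≤ a₀ i) (hfin : μZ {z | a < borelQuotHeight F E c N z} ≠ ∞)
    [hfin₀ : ∀ i, IsFiniteMeasure (weightedTruncMeasure F E c N k (a₀ i) μZ)] (hb : IotaBound F E c N k a μ μZ) (hb₀ : ∀ i, IotaBound F E c N k (a₀ i) μ μZ)
    (hcl₀ : ∀ i, IsClosed ((LinearMap.range (iota (hb₀ i)).toLinearMap : Submodule ℂ (HN F E c N k (a₀ i) μZ)) : Set (HN F E c N k (a₀ i) μZ)))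
    (hinj₀ : ∀ i, Function.Injective (iota (hb₀ i)))
    -- the good test functions and their transforms
    (h : I → (quasiSplit F E c N).Adelic → ℂ) (hhc : ∀ i, Continuous (h i)) (hhs : ∀ i, HasCompactSupport (h i))
    (hcov : ∀ z ∈ Metric.ball (0 : ℂ) (n + 2), ∃ i, (∫ x, h i x * (((borelHeight x : ℝ≥0) : ℝ) : ℂ) ^ z ∂νG) ≠ 0)
    (hĥ₀ : ∃ z ∈ Metric.ball (0 : ℂ) (n + 2), (∫ x, h i₀ x * (((borelHeight x : ℝ≥0) : ℝ) : ℂ) ^ z ∂νG) ≠ 0)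
    -- the `Z`-side Hecke operators (★ `ShiftBound`) and K2's decay letters
    (hs : ∀ i, ShiftBound F E c N k a (a₀ i) νG μZ (h i)) {m C : I → ℝ} (hm : ∀ i, 0 ≤ m i) (hC : ∀ i, 0 ≤ C i)
    (hK1 : ∀ i, ∀ f : HNcusp F E c N k a μZ, ∀ᵐ z ∂(weightedTruncMeasure F E c N k (a₀ i) μZ),
      ‖rightConvFun F E c N νG (h i) ((f : HN F E c N k a μZ) : borelQuotient F E c N → ℂ) z‖ ≤ C i * ‖f‖ * ((borelQuotHeight F E c N z : ℝ)) ^ (-m i))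
    -- the `𝔛`-side Hecke operators and the intertwining (P3-C)
    (T : I → HX F E c N k μ →L[ℂ] HX F E c N k μ) (hδι : ∀ i, deltaShift (hs i) ∘L iota hb = restrHN F E c N k (haa₀ i) μZ ∘L iota hb ∘L T i)
    -- the constant-term vectors (`=ᵐ` letters, `toHN` of `H^z`, `H^{1−z}`) and the cusp-orthogonality operator
    {α₁ α₂ : ℂ → HN F E c N k a μZ}
    (hα₁ : ∀ z ∈ Metric.ball (0 : ℂ) (n + 2), (α₁ z : borelQuotient F E c N → ℂ) =ᵐ[weightedTruncMeasure F E c N k a μZ] fun x => (((borelQuotHeight F E c N x : ℝ≥0) : ℝ) : ℂ) ^ z)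
    (hα₂ : ∀ z ∈ Metric.ball (0 : ℂ) (n + 2), (α₂ z : borelQuotient F E c N → ℂ) =ᵐ[weightedTruncMeasure F E c N k a μZ] fun x => (((borelQuotHeight F E c N x : ℝ≥0) : ℝ) : ℂ) ^ (1 - z))
    (hα₂ne : ∀ z ∈ Metric.ball (0 : ℂ) (n + 2), α₂ z ≠ 0) {X' : Type} [NormedAddCommGroup X'] [NormedSpace ℂ X'] [CompleteSpace X'] (Q : HX F E c N k μ →L[ℂ] X') (φ₀ : ℂ)
    -- the Eisenstein data in `𝓗_k(𝔛)` on the Godement set ((b1) + ℓ9 + P2b-A∕P7 + P7-B)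
    (eX : ℂ → HX F E c N k μ) (bX : ℂ → ℂ)
    (hsolT : ∀ z ∈ Metric.ball (0 : ℂ) (n + 2), 1 < z.re → ∀ i, T i (eX z) = (∫ x, h i x * (((borelHeight x : ℝ≥0) : ℝ) : ℂ) ^ z ∂νG) • eX z)
    (hsolC : ∀ z ∈ Metric.ball (0 : ℂ) (n + 2), 1 < z.re → cnstN F E c N k a μZ (iota hb (eX z)) = φ₀ • α₁ z + bX z • α₂ z)
    (hsolQ : ∀ z ∈ Metric.ball (0 : ℂ) (n + 2), 1 < z.re → Q (eX z) = 0)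
    -- uniqueness of the `ψ`-component on an open non-empty part of the Godement set (P6′)
    (hunq : ∃ U₀ : Set ℂ, IsOpen U₀ ∧ U₀.Nonempty ∧ U₀ ⊆ Metric.ball (0 : ℂ) (n + 2) ∩ {z : ℂ | 1 < z.re} ∧
      ∀ z ∈ U₀, ∀ (ψ : HX F E c N k μ) (b : ℂ), (∀ i, T i ψ = (∫ x, h i x * (((borelHeight x : ℝ≥0) : ℝ) : ℂ) ^ z ∂νG) • ψ) →
        cnstN F E c N k a μZ (iota hb ψ) = φ₀ • α₁ z + b • α₂ z → Q ψ = 0 → ψ = eX z)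
    -- the evaluation functional after `δ(h_{i₀})` at `g` (P3-D)
    (g : (quasiSplit F E c N).Adelic) (Λ : HX F E c N k μ →L[ℂ] ℂ)
    (hΛ : ∀ z ∈ Metric.ball (0 : ℂ) (n + 2), 1 < z.re →
      Λ (eX z) = (∫ x, h i₀ x * (((borelHeight x : ℝ≥0) : ℝ) : ℂ) ^ z ∂νG) * eisensteinSeriesU (flatSectionU (fun _ : (quasiSplit F E c N).Adelic => φ₀) z) g) :
    ∃ Ec : ℂ → ℂ, MeromorphicOn Ec (Metric.ball (0 : ℂ) (n + 2)) ∧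
      ∀ z ∈ Metric.ball (0 : ℂ) (n + 2), 1 < z.re → Ec z = eisensteinSeriesU (flatSectionU (fun _ : (quasiSplit F E c N).Adelic => φ₀) z) g := by
  -- the ball and the strip bounds for `α₁`, `α₂`
  have hD : IsOpen (Metric.ball (0 : ℂ) (n + 2)) := Metric.isOpen_ball
  have hDc : IsPreconnected (Metric.ball (0 : ℂ) (n + 2)) := (convex_ball (0 : ℂ) _).isPreconnected
  have hre : ∀ z ∈ Metric.ball (0 : ℂ) (n + 2), |z.re| < n + 2 := fun z hz =>
    lt_of_le_of_lt (Complex.abs_re_le_norm z) (by rwa [Metric.mem_ball, dist_zero_right] at hz)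
  -- holomorphy of the transforms and of `α₁`, `α₂`
  have hĥ : ∀ i, DifferentiableOn ℂ (fun z : ℂ => ∫ x, h i x * (((borelHeight x : ℝ≥0) : ℝ) : ℂ) ^ z ∂νG) (Metric.ball (0 : ℂ) (n + 2)) := fun i =>
    (differentiable_integral_mul_borelHeight_cpow νG (hhc i) (hhs i)).differentiableOn
  have hα₁d : DifferentiableOn ℂ α₁ (Metric.ball (0 : ℂ) (n + 2)) :=
    differentiableOn_HN_of_ae_eq_cpow_self (σ₀ := -((n : ℝ) + 2)) (σ₁ := (n : ℝ) + 2) ha hfin (by linarith) (by linarith) hD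
      (fun z hz => ⟨by linarith [(abs_lt.1 (hre z hz)).1], by linarith [(abs_lt.1 (hre z hz)).2]⟩) hα₁
  have hα₂d : DifferentiableOn ℂ α₂ (Metric.ball (0 : ℂ) (n + 2)) :=
    differentiableOn_HN_of_ae_eq_cpow_one_sub (σ₀ := -((n : ℝ) + 1)) (σ₁ := (n : ℝ) + 3) ha hfin (by linarith) (by linarith) hD
      (fun z hz => ⟨by linarith [(abs_lt.1 (hre z hz)).2], by linarith [(abs_lt.1 (hre z hz)).1]⟩) hα₂
  -- the packaged `𝔛`-system (★ G-c) over the concrete letters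
  haveI : CompleteSpace ((I → HX F E c N k μ) × (HN F E c N k a μZ × X')) := inferInstance
  obtain ⟨A, cc, hA, hcc, hchar, hfinT⟩ := exists_xSystem (V₀ := fun i => HN F E c N k (a₀ i) μZ) hD T hĥ hcov (iota hb) (cnstN F E c N k a μZ) Q hα₁d hα₂d φ₀
    (fun i => deltaShift (hs i)) (fun i => restrHN F E c N k (haa₀ i) μZ) (fun i => piN (hb₀ i) (hcl₀ i) (hinj₀ i)) hδι
    (fun i => piN_comp_restrHN_comp_iota (haa₀ i) hb (hb₀ i) (hcl₀ i) (hinj₀ i))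
    (fun i => isCompactOperator_deltaShift_comp_one_sub_cnstN (lt_of_lt_of_le ha (haa₀ i)) (hs i) (hm i) (hC i) (hK1 i))
  -- existence on the Godement set, uniqueness on `U₀`, the functional identity; assemble
  have hsol : ∀ z ∈ Metric.ball (0 : ℂ) (n + 2) ∩ {z : ℂ | 1 < z.re}, A z (eX z, bX z) = cc z := fun z hz =>
    (hchar z (eX z) (bX z)).2 ⟨hsolT z hz.1 hz.2, hsolC z hz.1 hz.2, hsolQ z hz.1 hz.2⟩
  obtain ⟨U₀, hU₀o, hU₀ne, hU₀D, hU₀unq⟩ := hunq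
  have hunq' : ∃ U₀ : Set ℂ, IsOpen U₀ ∧ U₀.Nonempty ∧ U₀ ⊆ Metric.ball (0 : ℂ) (n + 2) ∩ {z : ℂ | 1 < z.re} ∧ ∀ z ∈ U₀, ∀ w : HX F E c N k μ × ℂ, A z w = cc z → w = (eX z, bX z) := by
    refine ⟨U₀, hU₀o, hU₀ne, hU₀D, fun z hz w hw => ?_⟩
    have hex : ∃! x : HX F E c N k μ × ℂ, A z x = cc z :=
      xSystem_existsUnique_of hchar (hα₂ne z (hU₀D hz).1) (hsol z (hU₀D hz)) fun ψ b hψb =>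
        hU₀unq z hz ψ b ((hchar z ψ b).1 hψb).1 ((hchar z ψ b).1 hψb).2.1 ((hchar z ψ b).1 hψb).2.2
    exact hex.unique hw (hsol z (hU₀D hz))
  have hΛ' : ∀ z ∈ Metric.ball (0 : ℂ) (n + 2) ∩ {z : ℂ | 1 < z.re}, (Λ ∘L ContinuousLinearMap.fst ℂ (HX F E c N k μ) ℂ) (eX z, bX z) =
      (∫ x, h i₀ x * (((borelHeight x : ℝ≥0) : ℝ) : ℂ) ^ z ∂νG) * eisensteinSeriesU (flatSectionU (fun _ : (quasiSplit F E c N).Adelic => φ₀) z) g := fun z hz => by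
    show Λ (eX z) = _
    exact hΛ z hz.1 hz.2
  obtain ⟨Ec, hEc, hEcE⟩ := exists_meromorphicOn_scalar_of_system' (O := {z : ℂ | 1 < z.re})
    (E := fun z => eisensteinSeriesU (flatSectionU (fun _ : (quasiSplit F E c N).Adelic => φ₀) z) g) hD hDc hA hcc hfinT (hĥ i₀) hĥ₀ hsol hunq'
    (Λ ∘L ContinuousLinearMap.fst ℂ (HX F E c N k μ) ℂ) hΛ'
  exact ⟨Ec, hEc, fun z _ hz1 => hEcE z hz1⟩

end Ball

end Summit.HodgeConjecture.HodgeConjecture.Cruxes.H413.K2E1SphericalEisensteinMeromorphicBallU2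

end
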